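import Summits.KontsevichZagierPeriods.KontsevichZagierPeriods.Theorems.SymplecticScissorsRealOnePeriodRelationsStubCellsAux
import Literature.NumberTheory.Transcendental.EllIterRep
import Mathlib.Analysis.SpecialFunctions.Sqrt

/-!
# `RealOnePeriodRelations` (stmt-KontsevichZagierPeriods-10042), line `nash-retraction-thin-strip`,
# the bielliptic layer: the stub `stub_biellSquareCell`

`BiellipticLayer.stub_biellSquareCell`: on a real oval `(a, b)`, `0 < a < b`, of the bielliptic
sextic `S(x) = P(x²)`, `P(u) = p₃u³ + p₂u² + p₁u + p₀` over `ℚ̄ ∩ ℝ` (`S(a) = S(b) = 0`, `S > 0` on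
`(a, b)`, `P′(a²) > 0 > P′(b²)`), the complete genus-2 integral `∫_a^b (c₀ + c₁x) dx/√S(x)` is ONE
instance of Kontsevich–Zagier's rule (2) — the semialgebraic chart `u = x²` of the oval onto
`(a², b²)`, `dx = du/(2√u)`, push-forward integrand
`(c₀ + c₁√u)/(2√u·√P(u)) = (c₀/2)/√(u·P(u)) + (c₁/2)/√P(u)` — followed by ONE instance of rule (1b)
(additivity of the integrand) away from `[r₁] + [r₂]`, `r₁ = ∫_{a²}^{b²} (c₀/2) du/√(u·P(u))` (a
real oval of the quartic `u·P(u)`), `r₂ = ∫_{a²}^{b²} (c₁/2) du/√P(u)` (a real oval of the cubic `P`).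

The absolute convergence of `r₁`, `r₂` (a field of `KZ.IntegralRep`) is NOT a consequence of that
of `r` (take `S = (x² − a²)²·(x² + 1)`, `c₀ + c₁x = x − a`: `r` converges, `∫ du/√P` does not); it
is supplied by the simple-root hypotheses `P′(a²) > 0 > P′(b²)`: then `P(u) = (u − a²)(b² − u)R(u)`
with `R` affine and positive at both end points, so `1/√P ≤ K^{-1/2}((√(u − a²))⁻¹ + (√(b² − u))⁻¹)`
on the oval (`integrableOn_inv_sqrt_cubicOval`).

References: M. Kontsevich, D. Zagier, *Periods* (2001), §1.2 rules (1b), (2); J. Bochnak,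
M. Coste, M.-F. Roy, *Real Algebraic Geometry* (1998), §2.2.
-/

noncomputable section

open Set MeasureTheory
open Literature.NumberTheory.Transcendental Literature.ModelTheory.ExponentialFields

namespace Summit.KontsevichZagierPeriods.SymplecticScissors.RealOnePeriodRelations.BiellipticLayer

/-- **`du/√P` converges on a real oval with simple end points.** For a real cubic
`P(u) = p₃u³ + p₂u² + p₁u + p₀` vanishing at `α < β` with `P′(α) > 0 > P′(β)`, `(√P)⁻¹` is
integrable on `(α, β)`: `P(u) = (u − α)(β − u)R(u)` with `R` affine, `R(α) = P′(α)/(β − α) > 0`,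
`R(β) = −P′(β)/(β − α) > 0`, so `R ≥ min (R α) (R β) > 0` on `[α, β]` and `1/√P` is dominated by
`K^{-1/2}((√(u − α))⁻¹ + (√(β − u))⁻¹)`, `K = min (R α) (R β) · (β − α)/2`.
[cite: KontsevichZagier2001, §1.2 (rules 1b, 2)] -/
theorem integrableOn_inv_sqrt_cubicOval {p₃ p₂ p₁ p₀ α β : ℝ} (hαβ : α < β)
    (hα : p₃ * α ^ 3 + p₂ * α ^ 2 + p₁ * α + p₀ = 0)
    (hβ : p₃ * β ^ 3 + p₂ * β ^ 2 + p₁ * β + p₀ = 0)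
    (hdα : 0 < 3 * p₃ * α ^ 2 + 2 * p₂ * α + p₁)
    (hdβ : 3 * p₃ * β ^ 2 + 2 * p₂ * β + p₁ < 0) :
    IntegrableOn (fun u : ℝ => (Real.sqrt (p₃ * u ^ 3 + p₂ * u ^ 2 + p₁ * u + p₀))⁻¹)
      (Ioo α β) := by
  -- the affine cofactor `R` of `(u − α)(β − u)` in `P`
  obtain ⟨R, hR⟩ : ∃ R : ℝ → ℝ, ∀ u, R u = -(p₃ * u + (α + β) * p₃ + p₂) := ⟨_, fun _ => rfl⟩
  have hβα : 0 < β - α := sub_pos.2 hαβ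
  have hfac : ∀ u : ℝ,
      p₃ * u ^ 3 + p₂ * u ^ 2 + p₁ * u + p₀ = (u - α) * (β - u) * R u := by
    intro u
    have h : (β - α) * (p₃ * u ^ 3 + p₂ * u ^ 2 + p₁ * u + p₀ - (u - α) * (β - u) * R u) = 0 := by
      rw [hR]
      linear_combination (β - u) * hα + (u - α) * hβ
    have h' := (mul_eq_zero.mp h).resolve_left hβα.ne'
    linarith
  -- `R > 0` at the two end points (simple roots) …
  have hRα : 0 < R α := by
    have h : (α - β) * ((3 * p₃ * α ^ 2 + 2 * p₂ * α + p₁) - (β - α) * R α) = 0 := by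
      rw [hR]
      linear_combination hα - hβ
    have h' := (mul_eq_zero.mp h).resolve_left (sub_ne_zero.2 hαβ.ne)
    nlinarith
  have hRβ : 0 < R β := by
    have h : (α - β) * ((3 * p₃ * β ^ 2 + 2 * p₂ * β + p₁) + (β - α) * R β) = 0 := by
      rw [hR]
      linear_combination hα - hβ
    have h' := (mul_eq_zero.mp h).resolve_left (sub_ne_zero.2 hαβ.ne)
    nlinarith
  -- … hence bounded below by `m = min (R α) (R β) > 0` on the oval (`R` is affine)
  set m : ℝ := min (R α) (R β) with hm_def
  have hm : 0 < m := lt_min hRα hRβ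
  have hmle : ∀ u ∈ Ioo α β, m ≤ R u := by
    intro u hu
    have e : (β - α) * R u = (β - u) * R α + (u - α) * R β := by
      simp only [hR]
      ring
    have h1 : (β - u) * m ≤ (β - u) * R α :=
      mul_le_mul_of_nonneg_left (min_le_left _ _) (sub_pos.2 hu.2).le
    have h2 : (u - α) * m ≤ (u - α) * R β :=
      mul_le_mul_of_nonneg_left (min_le_right _ _) (sub_pos.2 hu.1).le
    have h3 : (β - α) * m ≤ (β - α) * R u := by
      rw [e]
      linarith
    exact le_of_mul_le_mul_left h3 hβα
  -- the two one-sided lower bounds `P ≥ K (u − α)`, `P ≥ K (β − u)`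
  obtain ⟨K, hK, hlow⟩ : ∃ K : ℝ, 0 < K ∧ ∀ u ∈ Ioo α β,
      (u - α ≤ β - u → K * (u - α) ≤ p₃ * u ^ 3 + p₂ * u ^ 2 + p₁ * u + p₀) ∧
      (β - u ≤ u - α → K * (β - u) ≤ p₃ * u ^ 3 + p₂ * u ^ 2 + p₁ * u + p₀) := by
    refine ⟨m * ((β - α) / 2), mul_pos hm (by linarith), fun u hu => ⟨fun h => ?_, fun h => ?_⟩⟩
    · have hRu := hmle u hu
      have key : m * ((β - α) / 2) ≤ R u * (β - u) :=
        mul_le_mul hRu (by linarith) (by linarith) (hm.le.trans hRu)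
      calc m * ((β - α) / 2) * (u - α) ≤ R u * (β - u) * (u - α) :=
            mul_le_mul_of_nonneg_right key (sub_pos.2 hu.1).le
        _ = p₃ * u ^ 3 + p₂ * u ^ 2 + p₁ * u + p₀ := by rw [hfac]; ring
    · have hRu := hmle u hu
      have key : m * ((β - α) / 2) ≤ R u * (u - α) :=
        mul_le_mul hRu (by linarith) (by linarith) (hm.le.trans hRu)
      calc m * ((β - α) / 2) * (β - u) ≤ R u * (u - α) * (β - u) :=
            mul_le_mul_of_nonneg_right key (sub_pos.2 hu.2).le
        _ = p₃ * u ^ 3 + p₂ * u ^ 2 + p₁ * u + p₀ := by rw [hfac]; ring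
  -- domination by the integrable majorant `K^{-1/2}((√(u − α))⁻¹ + (√(β − u))⁻¹)`
  have hmaj : IntegrableOn
      (fun u => (Real.sqrt K)⁻¹ * ((Real.sqrt (u - α))⁻¹ + (Real.sqrt (β - u))⁻¹)) (Ioo α β) :=
    ((KZ.integrableOn_inv_sqrt_sub_left _ _).add
      (KZ.integrableOn_inv_sqrt_sub_right _ _)).const_mul _
  refine Integrable.mono' hmaj ?_ ?_
  · have hc : Continuous fun u : ℝ => p₃ * u ^ 3 + p₂ * u ^ 2 + p₁ * u + p₀ := by fun_prop
    exact (hc.sqrt.measurable.inv).aestronglyMeasurable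
  · filter_upwards [ae_restrict_mem measurableSet_Ioo] with u hu
    obtain ⟨h₁, h₂⟩ := hu
    rw [Real.norm_of_nonneg (inv_nonneg.2 (Real.sqrt_nonneg _))]
    have hA : 0 ≤ (Real.sqrt (u - α))⁻¹ := inv_nonneg.2 (Real.sqrt_nonneg _)
    have hB : 0 ≤ (Real.sqrt (β - u))⁻¹ := inv_nonneg.2 (Real.sqrt_nonneg _)
    have hKi : 0 ≤ (Real.sqrt K)⁻¹ := inv_nonneg.2 (Real.sqrt_nonneg _)
    rcases le_total (u - α) (β - u) with h | h
    · have hfx := (hlow u ⟨h₁, h₂⟩).1 h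
      calc (Real.sqrt (p₃ * u ^ 3 + p₂ * u ^ 2 + p₁ * u + p₀))⁻¹
            ≤ (Real.sqrt (K * (u - α)))⁻¹ :=
            inv_anti₀ (Real.sqrt_pos.2 (mul_pos hK (sub_pos.2 h₁))) (Real.sqrt_le_sqrt hfx)
        _ = (Real.sqrt K)⁻¹ * (Real.sqrt (u - α))⁻¹ := by rw [Real.sqrt_mul hK.le, mul_inv]
        _ ≤ (Real.sqrt K)⁻¹ * ((Real.sqrt (u - α))⁻¹ + (Real.sqrt (β - u))⁻¹) :=
            mul_le_mul_of_nonneg_left (le_add_of_nonneg_right hB) hKi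
    · have hfx := (hlow u ⟨h₁, h₂⟩).2 h
      calc (Real.sqrt (p₃ * u ^ 3 + p₂ * u ^ 2 + p₁ * u + p₀))⁻¹
            ≤ (Real.sqrt (K * (β - u)))⁻¹ :=
            inv_anti₀ (Real.sqrt_pos.2 (mul_pos hK (sub_pos.2 h₂))) (Real.sqrt_le_sqrt hfx)
        _ = (Real.sqrt K)⁻¹ * (Real.sqrt (β - u))⁻¹ := by rw [Real.sqrt_mul hK.le, mul_inv]
        _ ≤ (Real.sqrt K)⁻¹ * ((Real.sqrt (u - α))⁻¹ + (Real.sqrt (β - u))⁻¹) :=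
            mul_le_mul_of_nonneg_left (le_add_of_nonneg_left hA) hKi

/-- **The rule (2) move of the bielliptic square cell.** Push a representation on the oval
`{z | z 0 ∈ (a, b)}`, `0 < a < b`, with integrand `(c₀ + c₁x)/√S(x)`, `S(x) = P(x²) > 0` inside,
forward along the chart `x ↦ x²` (`ℚ`-semialgebraic, derivative `2x ≠ 0`, injective on the oval;
`HermiteRigidity.GenusTwoCycleTransfer.stub_pushforwardDimOne` with the semialgebraic inverse of
`stub_semialgebraicInvFunOn`): the push-forward `s` has domain `{z | z 0 ∈ (a², b²)}`, integrand
`(c₀/2)/√(u·P(u)) + (c₁/2)/√P(u)` there (`√(x²·S(x)) = x·√S(x)` for `x > 0`), and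
`[r] − [s] ∈ KZ.changeOfVariablesRel`. [cite: KontsevichZagier2001, §1.2 (rules 1b, 2)] -/
theorem biellSquareCell_pushforward {p₃ p₂ p₁ p₀ a b c₀ c₁ : ℝ} (h0a : 0 < a) (hab : a < b)
    (hpos : ∀ x ∈ Set.Ioo a b, 0 < p₃ * x ^ 6 + p₂ * x ^ 4 + p₁ * x ^ 2 + p₀)
    (r : KZ.IntegralRep 1) (hdom : r.domain = {z | z 0 ∈ Set.Ioo a b})
    (hint : ∀ z ∈ r.domain, r.integrand z =
      (c₀ + c₁ * z 0) / Real.sqrt (p₃ * (z 0) ^ 6 + p₂ * (z 0) ^ 4 + p₁ * (z 0) ^ 2 + p₀)) :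
    ∃ s : KZ.IntegralRep 1, s.domain = {z | z 0 ∈ Set.Ioo (a ^ 2) (b ^ 2)} ∧
      (∀ z ∈ s.domain, s.integrand z =
        (c₀ / 2) / Real.sqrt (p₃ * (z 0) ^ 4 + p₂ * (z 0) ^ 3 + p₁ * (z 0) ^ 2 + p₀ * (z 0)) +
        (c₁ / 2) / Real.sqrt (p₃ * (z 0) ^ 3 + p₂ * (z 0) ^ 2 + p₁ * (z 0) + p₀)) ∧
      KZ.of r - KZ.of s ∈ KZ.changeOfVariablesRel := by
  have hσ := r.isSemialgebraic_domain
  have hmem : ∀ p ∈ r.domain, p 0 ∈ Set.Ioo a b := fun p hp => by rw [hdom] at hp; exact hp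
  have hxpos : ∀ p ∈ r.domain, 0 < p 0 := fun p hp => h0a.trans (hmem p hp).1
  -- the chart `φ x = x²` and its derivative `φ' x = 2x`, as opaque functions
  obtain ⟨φ, hφ⟩ : ∃ φ : ℝ → ℝ, ∀ t, φ t = t ^ 2 := ⟨_, fun _ => rfl⟩
  obtain ⟨φ', hφ'⟩ : ∃ φ' : ℝ → ℝ, ∀ t, φ' t = 2 * t := ⟨_, fun _ => rfl⟩
  have h0 : IsSemialgebraicFunOn ℚ r.domain (fun p : Fin 1 → ℝ => p 0) :=
    isSemialgebraicFunOn_apply hσ 0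
  have hφs : IsSemialgebraicFunOn ℚ r.domain (fun p => φ (p 0)) :=
    (h0.fun_pow 2).congr fun p _ => (hφ (p 0)).symm
  have hφ's : IsSemialgebraicFunOn ℚ r.domain (fun p => φ' (p 0)) :=
    ((isSemialgebraicFunOn_const_ofNat hσ 2).fun_mul h0).congr fun p _ => (hφ' (p 0)).symm
  have hder : ∀ p ∈ r.domain, HasDerivAt φ (φ' (p 0)) (p 0) := fun p _ => by
    rw [show φ = fun t => t ^ 2 from funext hφ, hφ']
    simpa using hasDerivAt_pow 2 (p 0)
  have hne : ∀ p ∈ r.domain, φ' (p 0) ≠ 0 := fun p hp => by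
    rw [hφ']
    exact (mul_pos two_pos (hxpos p hp)).ne'
  have hinj : InjOn (fun p : Fin 1 → ℝ => fun _ : Fin 1 => φ (p 0)) r.domain := by
    intro p hp p' hp' h
    have h1 : φ (p 0) = φ (p' 0) := congrFun h 0
    rw [hφ, hφ] at h1
    have h2 : p 0 = p' 0 := (sq_eq_sq₀ (hxpos p hp).le (hxpos p' hp').le).mp h1
    rw [KZ.eq_const_apply_zero p, KZ.eq_const_apply_zero p', h2]
  have hΦsa : IsSemialgebraicMapOn ℚ r.domain (fun p : Fin 1 → ℝ => fun _ : Fin 1 => φ (p 0)) :=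
    IsSemialgebraicMapOn.of_forall hσ fun _ => hφs
  have hG := HermiteRigidity.GenusTwoCycleTransfer.stub_semialgebraicInvFunOn hΦsa hinj
  obtain ⟨s, hs, hsi, hrel⟩ := HermiteRigidity.GenusTwoCycleTransfer.stub_pushforwardDimOne r φ φ'
    _ hφs hφ's hder hne hG (fun p hp => hinj.leftInvOn_invFunOn hp)
  refine ⟨s, ?_, ?_, hrel⟩
  · -- the image of the oval `(a, b)` under `x ↦ x²` is `(a², b²)`
    rw [hs]
    ext z
    constructor
    · rintro ⟨p, hp, rfl⟩
      obtain ⟨h1, h2⟩ := hmem p hp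
      show φ (p 0) ∈ Set.Ioo (a ^ 2) (b ^ 2)
      rw [hφ]
      exact ⟨pow_lt_pow_left₀ h1 h0a.le two_ne_zero, pow_lt_pow_left₀ h2 (hxpos p hp).le two_ne_zero⟩
    · rintro ⟨h1, h2⟩
      have hz0 : 0 < z 0 := (pow_pos h0a 2).trans h1
      refine ⟨fun _ => Real.sqrt (z 0), ?_, ?_⟩
      · rw [hdom]
        show Real.sqrt (z 0) ∈ Set.Ioo a b
        exact ⟨(Real.lt_sqrt h0a.le).2 h1, (Real.sqrt_lt' (h0a.trans hab)).2 h2⟩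
      · rw [KZ.eq_const_apply_zero z]
        funext i
        show φ (Real.sqrt (z 0)) = z 0
        rw [hφ]
        exact Real.sq_sqrt hz0.le
  · -- the integrand of the push-forward
    intro z hz
    rw [hs] at hz
    obtain ⟨p, hp, rfl⟩ := hz
    have hx := hxpos p hp
    have hS := hpos (p 0) (hmem p hp)
    show s.integrand (fun _ => φ (p 0)) =
      (c₀ / 2) / Real.sqrt (p₃ * φ (p 0) ^ 4 + p₂ * φ (p 0) ^ 3 + p₁ * φ (p 0) ^ 2 + p₀ * φ (p 0)) +
      (c₁ / 2) / Real.sqrt (p₃ * φ (p 0) ^ 3 + p₂ * φ (p 0) ^ 2 + p₁ * φ (p 0) + p₀)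
    rw [hsi p hp, hint p hp, hφ, hφ']
    have e1 : p₃ * (p 0 ^ 2) ^ 4 + p₂ * (p 0 ^ 2) ^ 3 + p₁ * (p 0 ^ 2) ^ 2 + p₀ * p 0 ^ 2 =
        p 0 ^ 2 * (p₃ * p 0 ^ 6 + p₂ * p 0 ^ 4 + p₁ * p 0 ^ 2 + p₀) := by ring
    have e2 : p₃ * (p 0 ^ 2) ^ 3 + p₂ * (p 0 ^ 2) ^ 2 + p₁ * p 0 ^ 2 + p₀ =
        p₃ * p 0 ^ 6 + p₂ * p 0 ^ 4 + p₁ * p 0 ^ 2 + p₀ := by ring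
    rw [e1, e2, Real.sqrt_mul (sq_nonneg _), Real.sqrt_sq hx.le, abs_of_pos (mul_pos two_pos hx)]
    have hSne : Real.sqrt (p₃ * p 0 ^ 6 + p₂ * p 0 ^ 4 + p₁ * p 0 ^ 2 + p₀) ≠ 0 :=
      (Real.sqrt_pos.2 hS).ne'
    field_simp

/-- The statement of `stub_biellSquareCell`, proved: rule (2) along `x ↦ x²`
(`biellSquareCell_pushforward`), then rule (1b) splitting the push-forward integrand
`(c₀/2)/√(u·P(u)) + (c₁/2)/√P(u)` into the two representations `r₁`, `r₂` on `(a², b²)`, which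
converge absolutely by `integrableOn_inv_sqrt_cubicOval` (`(√u)⁻¹` is bounded on `[a², b²]`,
`a > 0`).  (The algebraicity of `a`, `b` is not needed: the new domain is semialgebraic as the
image of the old one.) [cite: KontsevichZagier2001, §1.2 (rules 1b, 2)] -/
theorem biellSquareCell_of (p₃ p₂ p₁ p₀ : ℝ) (hp₃ : IsAlgebraic ℚ p₃) (hp₂ : IsAlgebraic ℚ p₂)
    (hp₁ : IsAlgebraic ℚ p₁) (hp₀ : IsAlgebraic ℚ p₀) (a b c₀ c₁ : ℝ) (_ha : IsAlgebraic ℚ a)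
    (_hb : IsAlgebraic ℚ b) (hc₀ : IsAlgebraic ℚ c₀) (hc₁ : IsAlgebraic ℚ c₁) (h0a : 0 < a)
    (hab : a < b)
    (hpos : ∀ x ∈ Set.Ioo a b, 0 < p₃ * x ^ 6 + p₂ * x ^ 4 + p₁ * x ^ 2 + p₀)
    (hSa : p₃ * a ^ 6 + p₂ * a ^ 4 + p₁ * a ^ 2 + p₀ = 0) (hSb : p₃ * b ^ 6 + p₂ * b ^ 4 + p₁ * b ^ 2 + p₀ = 0)
    (hda : 0 < 3 * p₃ * a ^ 4 + 2 * p₂ * a ^ 2 + p₁) (hdb : 3 * p₃ * b ^ 4 + 2 * p₂ * b ^ 2 + p₁ < 0)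
    (r : KZ.IntegralRep 1) (hdom : r.domain = {z | z 0 ∈ Set.Ioo a b})
    (hint : ∀ z ∈ r.domain, r.integrand z = (c₀ + c₁ * z 0) / Real.sqrt (p₃ * (z 0) ^ 6 + p₂ * (z 0) ^ 4 + p₁ * (z 0) ^ 2 + p₀)) :
    ∃ r₁ r₂ : KZ.IntegralRep 1,
      r₁.domain = {z | z 0 ∈ Set.Ioo (a ^ 2) (b ^ 2)} ∧ r₂.domain = {z | z 0 ∈ Set.Ioo (a ^ 2) (b ^ 2)} ∧
      (∀ z ∈ r₁.domain, r₁.integrand z =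
        (c₀ / 2) / Real.sqrt (p₃ * (z 0) ^ 4 + p₂ * (z 0) ^ 3 + p₁ * (z 0) ^ 2 + p₀ * (z 0))) ∧
      (∀ z ∈ r₂.domain, r₂.integrand z = (c₁ / 2) / Real.sqrt (p₃ * (z 0) ^ 3 + p₂ * (z 0) ^ 2 + p₁ * (z 0) + p₀)) ∧
      KZ.of r - KZ.of r₁ - KZ.of r₂ ∈
        AddSubgroup.closure (KZ.domainAddRel ∪ KZ.integrandAddRel ∪ KZ.changeOfVariablesRel) := by
  -- rule (2): the push-forward `s` of `r` along `x ↦ x²`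
  obtain ⟨s, hs, hsi, hrel⟩ := biellSquareCell_pushforward h0a hab hpos r hdom hint
  have hσ := s.isSemialgebraic_domain
  -- absolute convergence of `du/√P` on `(a², b²)` (simple end points)
  have hab2 : a ^ 2 < b ^ 2 := pow_lt_pow_left₀ hab h0a.le two_ne_zero
  have hα : p₃ * (a ^ 2) ^ 3 + p₂ * (a ^ 2) ^ 2 + p₁ * a ^ 2 + p₀ = 0 := by rw [← hSa]; ring
  have hβ : p₃ * (b ^ 2) ^ 3 + p₂ * (b ^ 2) ^ 2 + p₁ * b ^ 2 + p₀ = 0 := by rw [← hSb]; ring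
  have hdα : 0 < 3 * p₃ * (a ^ 2) ^ 2 + 2 * p₂ * a ^ 2 + p₁ := by
    calc (0 : ℝ) < 3 * p₃ * a ^ 4 + 2 * p₂ * a ^ 2 + p₁ := hda
      _ = 3 * p₃ * (a ^ 2) ^ 2 + 2 * p₂ * a ^ 2 + p₁ := by ring
  have hdβ : 3 * p₃ * (b ^ 2) ^ 2 + 2 * p₂ * b ^ 2 + p₁ < 0 := by
    calc 3 * p₃ * (b ^ 2) ^ 2 + 2 * p₂ * b ^ 2 + p₁ = 3 * p₃ * b ^ 4 + 2 * p₂ * b ^ 2 + p₁ := by ring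
      _ < 0 := hdb
  have hI := integrableOn_inv_sqrt_cubicOval hab2 hα hβ hdα hdβ
  -- the two integrands, over `ℝ`
  have hI₂ : IntegrableOn
      (fun u : ℝ => (c₁ / 2) / Real.sqrt (p₃ * u ^ 3 + p₂ * u ^ 2 + p₁ * u + p₀)) (Ioo (a ^ 2) (b ^ 2)) :=
    IntegrableOn.congr_fun (hI.const_mul (c₁ / 2)) (fun u _ => (div_eq_mul_inv _ _).symm)
      measurableSet_Ioo
  have hI₁ : IntegrableOn
      (fun u : ℝ => (c₀ / 2) / Real.sqrt (p₃ * u ^ 4 + p₂ * u ^ 3 + p₁ * u ^ 2 + p₀ * u))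
      (Ioo (a ^ 2) (b ^ 2)) := by
    have hcont : ContinuousOn (fun u : ℝ => (c₀ / 2) * (Real.sqrt u)⁻¹) (Icc (a ^ 2) (b ^ 2)) := by
      refine continuousOn_const.mul ((Real.continuous_sqrt.continuousOn).inv₀ fun u hu => ?_)
      exact (Real.sqrt_pos.2 ((pow_pos h0a 2).trans_le hu.1)).ne'
    refine (IntegrableOn.continuousOn_mul_of_subset hcont hI isCompact_Icc measurableSet_Ioo
      Ioo_subset_Icc_self).congr_fun (fun u hu => ?_) measurableSet_Ioo
    have hu0 : 0 < u := (pow_pos h0a 2).trans hu.1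
    show (c₀ / 2) * (Real.sqrt u)⁻¹ * (Real.sqrt (p₃ * u ^ 3 + p₂ * u ^ 2 + p₁ * u + p₀))⁻¹ =
      (c₀ / 2) / Real.sqrt (p₃ * u ^ 4 + p₂ * u ^ 3 + p₁ * u ^ 2 + p₀ * u)
    have e : p₃ * u ^ 4 + p₂ * u ^ 3 + p₁ * u ^ 2 + p₀ * u =
        u * (p₃ * u ^ 3 + p₂ * u ^ 2 + p₁ * u + p₀) := by ring
    rw [e, Real.sqrt_mul hu0.le, div_eq_mul_inv (c₀ / 2), mul_inv, mul_assoc]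
  -- transport of integrability to `ℝ¹` along `x ↦ x 0`
  have hT : ∀ {F : ℝ → ℝ}, IntegrableOn F (Ioo (a ^ 2) (b ^ 2)) →
      IntegrableOn (fun x : Fin 1 → ℝ => F (x 0)) s.domain := by
    intro F hF
    rw [hs]
    exact ((volume_preserving_funUnique (Fin 1) ℝ).integrableOn_comp_preimage
      (MeasurableEquiv.funUnique (Fin 1) ℝ).measurableEmbedding (f := F)
      (s := Ioo (a ^ 2) (b ^ 2))).2 hF
  -- the two integrands on `ℝ¹`, as opaque functions
  obtain ⟨f₁, hf₁⟩ : ∃ f : (Fin 1 → ℝ) → ℝ, ∀ z, f z =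
      (c₀ / 2) / Real.sqrt (p₃ * (z 0) ^ 4 + p₂ * (z 0) ^ 3 + p₁ * (z 0) ^ 2 + p₀ * (z 0)) :=
    ⟨_, fun _ => rfl⟩
  obtain ⟨f₂, hf₂⟩ : ∃ f : (Fin 1 → ℝ) → ℝ, ∀ z, f z =
      (c₁ / 2) / Real.sqrt (p₃ * (z 0) ^ 3 + p₂ * (z 0) ^ 2 + p₁ * (z 0) + p₀) :=
    ⟨_, fun _ => rfl⟩
  -- semialgebraicity of the two integrands (polynomials with algebraic coefficients, `√`, `⁻¹`)
  have h0 : IsSemialgebraicFunOn ℚ s.domain (fun z : Fin 1 → ℝ => z 0) :=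
    isSemialgebraicFunOn_apply hσ 0
  have k₃ := isSemialgebraicFunOn_const_of_isAlgebraic hσ hp₃
  have k₂ := isSemialgebraicFunOn_const_of_isAlgebraic hσ hp₂
  have k₁ := isSemialgebraicFunOn_const_of_isAlgebraic hσ hp₁
  have k₀ := isSemialgebraicFunOn_const_of_isAlgebraic hσ hp₀
  have hP : IsSemialgebraicFunOn ℚ s.domain
      (fun z => p₃ * (z 0) ^ 3 + p₂ * (z 0) ^ 2 + p₁ * (z 0) + p₀) :=
    (((k₃.fun_mul (h0.fun_pow 3)).fun_add (k₂.fun_mul (h0.fun_pow 2))).fun_add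
      (k₁.fun_mul h0)).fun_add k₀
  have hQ : IsSemialgebraicFunOn ℚ s.domain
      (fun z => p₃ * (z 0) ^ 4 + p₂ * (z 0) ^ 3 + p₁ * (z 0) ^ 2 + p₀ * (z 0)) :=
    (((k₃.fun_mul (h0.fun_pow 4)).fun_add (k₂.fun_mul (h0.fun_pow 3))).fun_add
      (k₁.fun_mul (h0.fun_pow 2))).fun_add (k₀.fun_mul h0)
  have hhalf : ∀ {c : ℝ}, IsAlgebraic ℚ c → IsSemialgebraicFunOn ℚ s.domain (fun _ => c / 2) :=
    fun hc => ((isSemialgebraicFunOn_const_of_isAlgebraic hσ hc).fun_mul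
      (isSemialgebraicFunOn_const_ofNat hσ 2).fun_inv).congr fun _ _ => (div_eq_mul_inv _ _).symm
  have hf₁s : IsSemialgebraicFunOn ℚ s.domain f₁ :=
    ((hhalf hc₀).fun_mul hQ.fun_sqrt.fun_inv).congr fun z _ => by rw [hf₁, div_eq_mul_inv (c₀ / 2)]
  have hf₂s : IsSemialgebraicFunOn ℚ s.domain f₂ :=
    ((hhalf hc₁).fun_mul hP.fun_sqrt.fun_inv).congr fun z _ => by rw [hf₂, div_eq_mul_inv (c₁ / 2)]
  -- the two representations `r₁`, `r₂` on the domain of `s`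
  obtain ⟨r₁, hr₁d, hr₁i⟩ : ∃ r₁ : KZ.IntegralRep 1, r₁.domain = s.domain ∧ r₁.integrand = f₁ :=
    ⟨⟨s.domain, f₁, hσ, hf₁s, by rw [funext hf₁]; exact hT hI₁⟩, rfl, rfl⟩
  obtain ⟨r₂, hr₂d, hr₂i⟩ : ∃ r₂ : KZ.IntegralRep 1, r₂.domain = s.domain ∧ r₂.integrand = f₂ :=
    ⟨⟨s.domain, f₂, hσ, hf₂s, by rw [funext hf₂]; exact hT hI₂⟩, rfl, rfl⟩
  -- rule (1b): `[s] − [r₁] − [r₂]`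
  have h1b : KZ.of s - KZ.of r₁ - KZ.of r₂ ∈ KZ.integrandAddRel := by
    refine ⟨1, s, r₁, r₂, hr₁d, hr₂d, fun z hz => ?_, rfl⟩
    rw [Pi.add_apply, hr₁i, hr₂i, hf₁, hf₂]
    exact hsi z hz
  refine ⟨r₁, r₂, hr₁d.trans hs, hr₂d.trans hs, fun z _ => by rw [hr₁i, hf₁],
    fun z _ => by rw [hr₂i, hf₂], ?_⟩
  have e : KZ.of r - KZ.of r₁ - KZ.of r₂ = (KZ.of r - KZ.of s) + (KZ.of s - KZ.of r₁ - KZ.of r₂) := by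
    abel
  rw [e]
  exact AddSubgroup.add_mem _ (AddSubgroup.subset_closure (Or.inr hrel))
    (AddSubgroup.subset_closure (Or.inl (Or.inr h1b)))

/-- STUB `stub_biellSquareCell` — **the squaring move on a bielliptic oval.**  On a real oval
`(a, b)`, `0 < a < b`, of the bielliptic sextic `S(x) = P(x²)`, `P(u) = p₃u³ + p₂u² + p₁u + p₀` over
`ℚ̄ ∩ ℝ` (`S(a) = S(b) = 0`, `S > 0` on `(a, b)`, simple end points `P′(a²) > 0 > P′(b²)`), the
complete genus-2 integral `∫_a^b (c₀ + c₁x) dx/√S(x)` is ONE instance of Kontsevich–Zagier's rule (2)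
(the semialgebraic chart `u = x²`, `u ∈ (a², b²)`, `dx = du/(2√u)`) followed by rule (1b) away from
the sum of the complete elliptic integrals `∫_{a²}^{b²} (c₀/2) du/√(u·P(u))` (a real oval of the
quartic `uP(u) = p₃u⁴ + p₂u³ + p₁u² + p₀u`) and `∫_{a²}^{b²} (c₁/2) du/√P(u)` (a real oval of the cubic
`P`): `[r] − [r₁] − [r₂] ∈ closure (1a ∪ 1b ∪ 2)`.  The simple-root hypotheses make `r₁`, `r₂`
absolutely convergent (`integrableOn_inv_sqrt_cubicOval`); without them the statement fails
(`S = (x² − a²)²(x² + 1)`, `c₀ + c₁x = x − a`). [cite: KontsevichZagier2001, §1.2 (rules 1b, 2)] -/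
theorem stub_biellSquareCell (p₃ p₂ p₁ p₀ : ℝ) (hp₃ : IsAlgebraic ℚ p₃) (hp₂ : IsAlgebraic ℚ p₂) (hp₁ : IsAlgebraic ℚ p₁)
    (hp₀ : IsAlgebraic ℚ p₀) (a b c₀ c₁ : ℝ) (ha : IsAlgebraic ℚ a) (hb : IsAlgebraic ℚ b) (hc₀ : IsAlgebraic ℚ c₀)
    (hc₁ : IsAlgebraic ℚ c₁) (h0a : 0 < a) (hab : a < b)
    (hpos : ∀ x ∈ Set.Ioo a b, 0 < p₃ * x ^ 6 + p₂ * x ^ 4 + p₁ * x ^ 2 + p₀)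
    (hSa : p₃ * a ^ 6 + p₂ * a ^ 4 + p₁ * a ^ 2 + p₀ = 0) (hSb : p₃ * b ^ 6 + p₂ * b ^ 4 + p₁ * b ^ 2 + p₀ = 0)
    (hda : 0 < 3 * p₃ * a ^ 4 + 2 * p₂ * a ^ 2 + p₁) (hdb : 3 * p₃ * b ^ 4 + 2 * p₂ * b ^ 2 + p₁ < 0)
    (r : KZ.IntegralRep 1) (hdom : r.domain = {z | z 0 ∈ Set.Ioo a b})
    (hint : ∀ z ∈ r.domain, r.integrand z = (c₀ + c₁ * z 0) / Real.sqrt (p₃ * (z 0) ^ 6 + p₂ * (z 0) ^ 4 + p₁ * (z 0) ^ 2 + p₀)) :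
    ∃ r₁ r₂ : KZ.IntegralRep 1,
      r₁.domain = {z | z 0 ∈ Set.Ioo (a ^ 2) (b ^ 2)} ∧ r₂.domain = {z | z 0 ∈ Set.Ioo (a ^ 2) (b ^ 2)} ∧
      (∀ z ∈ r₁.domain, r₁.integrand z =
        (c₀ / 2) / Real.sqrt (p₃ * (z 0) ^ 4 + p₂ * (z 0) ^ 3 + p₁ * (z 0) ^ 2 + p₀ * (z 0))) ∧
      (∀ z ∈ r₂.domain, r₂.integrand z = (c₁ / 2) / Real.sqrt (p₃ * (z 0) ^ 3 + p₂ * (z 0) ^ 2 + p₁ * (z 0) + p₀)) ∧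
      KZ.of r - KZ.of r₁ - KZ.of r₂ ∈
        AddSubgroup.closure (KZ.domainAddRel ∪ KZ.integrandAddRel ∪ KZ.changeOfVariablesRel) :=
  biellSquareCell_of p₃ p₂ p₁ p₀ hp₃ hp₂ hp₁ hp₀ a b c₀ c₁ ha hb hc₀ hc₁ h0a hab hpos hSa hSb hda hdb
    r hdom hint

end Summit.KontsevichZagierPeriods.SymplecticScissors.RealOnePeriodRelations.BiellipticLayer

end
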